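import Mathlib
import Literature.NumberTheory.LFunctions.Zhang2022.Section16AU018OfU015
import Literature.NumberTheory.LFunctions.Zhang2022.Section16AEq1612Weighted
import HarnessLib

/-!
# Zhang (2022) §16, u015 ⇒ u018 with the EULER-PRODUCT WEIGHT carried: the bookkeeping twin of
# `Section16AU018OfU015` for the honest (weighted, polynomial-rate) form of u015

Topic `Literature/NumberTheory/LFunctions/Zhang2022` (Landau–Siegel audit tree; verdict-neutral).
Y. Zhang, *Discrete mean estimates and the Landau–Siegel zero*, arXiv:2211.02515v1 (2022)
[Zhang2022LandauSiegel] — **an unrefereed manuscript under adjudication** (ZHANG-L discharge lane, WP16,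
chain of the leaf `Typed.Section16A.Eq16_12 c′`). The displays are CLAIM nodes of
`Zhang2022/TypedSection16A.lean`, stated not asserted: §16.u015 `Step16_u015` [Z22 p. 90, tex L4484],
§16.u018 `Step16_u018` [tex L4502], (16.5) `Eq16_5P` [p. 91, tex L4509].

READING REMARK (not a repair of the mathematics). The printed error of u015, «`O(α¹⁰⁰τ₂(d₁)Dpk/l₂)`»,
is uniform in `d₂, k`; the contour argument the text invokes («similar to the treatment of (7.19)») bounds
the integrand `κ̃₂(d₁;d₂k,s)λ₂(d₁d₂k,s)L(s+β₁,χ)/L(s,χ)·yˢδ(s)` on the line `σ = 1 − c/𝓛` only through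
`|κ̃₂| ≤ τ₂(d₁)∏_{p∣d₁}(1−p^{−σ})^{−2}`, `|λ₂(n,s)| ≤ ∏_{q∣n}(1+q^{−σ})(1−q^{−σ})^{−1}`, i.e. with an
Euler-product weight `∏_{q∣d₁d₂k}(1 + c₀/q^{9/10})`, which is NOT bounded by a fixed power of `𝓛` uniformly
in `d₁d₂k < 2P₄` (it reaches `exp(≍𝓛^{0.9}/log 𝓛)`). This file therefore carries the weight through the
two bookkeeping steps u015 ⇒ u018 ⇒ (16.5): it is summed against `|g̃₂(dk)|/d ≤ 1/d` and `|μχ(k)|/(kφ(k))`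
at the cost of fixed powers of `𝓛` (`∏ ≤ (1+c₀)^{⌈c₀⌉²+1}τ₂`, `Typed.Section16A.prod_primeFactors_weight_le`;
`Σ_{d≤K}τ₂(d)τ₅(d)/d ≪ (log K)¹⁰`; `k/φ(k) ≤ τ₂(k)`, `Σ_{k≤K}τ₂(k)²/k ≪ (log K)⁴`), and a polynomial rate
`𝓛⁻²⁰⁰` in u015 (what zl-libC-p3's `DeltaContourShift` engine delivers, `≤ C·M·y·𝓛⁻²⁰⁰⁰`) is ample:

* `step16_u018w_of_u015ww` — u015 with error `C·τ₂(d₁)·∏_{q∣d₁d₂k}(1+c₀/q^{9/10})·𝓛⁻²⁰⁰·Dpk/l₂` on the support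
  of `b₁` (`l₂ < 2T²P^{1/2}max(P₂,P₃)`) ⇒ u018 with error `C′·τ₂(k)·𝓛⁻⁸⁰·Dpk` (inline statements);
* divisor-sum tools for this and the companion step: `sum_tau_two_mul_tau_five_div_le`,
  `self_div_totient_le_tau_two` (`k/φ(k) ≤ τ₂(k)`), `sum_tau_two_div_totient_le` (`Σ_{k≤X}τ₂(k)/φ(k) ≪ (log X)⁴`).
The companion `Zhang2022/Section16AEq165Weighted.lean` finishes: weighted u018 ⇒ (16.5)ᴾ, and the compositions
down to the leaf `Eq16_12 c′` (with the weighted (16.10) edge of `Section16AEq1612Weighted`).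

No new definitions, no named facts, no `sorry`; u015/(16.10) (weighted) are hypotheses, never asserted. Nothing
here bears on Theorems 1–2 of the source or on Landau–Siegel zeros.

## References

* Y. Zhang, arXiv:2211.02515v1 (2022), §16 pp. 89–92, u015 tex L4484, u018 tex L4502, (16.5) tex L4509,
  (16.12) tex L4558; §7 (7.19)–(7.20) p. 40. [cite: Zhang2022LandauSiegel, §16 p.90 (u015)]
-/

noncomputable section

open Complex Real
open Literature.NumberTheory.LFunctions.Zhang2022
open Literature.NumberTheory.LFunctions.Zhang2022.Skeleton
open Literature.NumberTheory.LFunctions.Zhang2022.Typed.Section16ALeaves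

namespace Literature.NumberTheory.LFunctions.Zhang2022.Typed.Section16A

/-! ## Thresholds and small numerics -/

/-- `L₀ ≤ log D` once `D ≥ ⌈exp L₀⌉₊`. [folklore] -/
private theorem le_ell_of_ceil_exp_le'' {L₀ : ℝ} {D : ℕ} (hD : ⌈Real.exp L₀⌉₊ ≤ D) : L₀ ≤ ell D := by
  have h : Real.exp L₀ ≤ D := le_trans (Nat.le_ceil _) (by exact_mod_cast hD)
  exact (Real.le_log_iff_exp_le (lt_of_lt_of_le (Real.exp_pos _) h)).mpr h

/-- `1 + log ⌈P⌉ ≤ 3𝓛⁹` for `𝓛 ≥ 1`. [cite: Zhang2022LandauSiegel, §2 (2.6)] -/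
private theorem one_add_log_ceil_bigP_le' {D : ℕ} (hℓ : 1 ≤ ell D) :
    1 + Real.log (⌈bigP D⌉₊ : ℝ) ≤ 3 * ell D ^ 9 := by
  have hP1 : 1 ≤ bigP D := by rw [bigP]; exact Real.one_le_exp (by positivity)
  have hN : (⌈bigP D⌉₊ : ℝ) ≤ 2 * bigP D := by
    have := Nat.ceil_lt_add_one (show (0 : ℝ) ≤ bigP D by linarith)
    linarith
  have hNpos : (0 : ℝ) < (⌈bigP D⌉₊ : ℝ) := by
    have : (1 : ℝ) ≤ (⌈bigP D⌉₊ : ℝ) := by exact_mod_cast Nat.one_le_ceil_iff.mpr (by linarith)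
    linarith
  have hlog : Real.log (⌈bigP D⌉₊ : ℝ) ≤ Real.log 2 + ell D ^ 9 := by
    calc Real.log (⌈bigP D⌉₊ : ℝ) ≤ Real.log (2 * bigP D) := Real.log_le_log hNpos hN
      _ = Real.log 2 + ell D ^ 9 := by rw [Real.log_mul (by norm_num) (by linarith), bigP, Real.log_exp]
  have hℓ9 : 1 ≤ ell D ^ 9 := one_le_pow₀ hℓ
  linarith [Real.log_two_lt_d9]

/-- `log ⌊2P₄⌋ ≤ 522𝓛⁹` for `𝓛 ≥ 1`. [cite: Zhang2022LandauSiegel, §6 p.30 (P₄)] -/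
private theorem log_floor_two_P4_le' {D : ℕ} (hℓ : 1 ≤ ell D) :
    Real.log (⌊2 * P4 D⌋₊ : ℝ) ≤ 522 * ell D ^ 9 := by
  have hℓ0 : 0 < ell D := by linarith
  have hP0 : 0 < bigP D := Real.exp_pos _
  have ht0 : 0 < t0 D := by rw [t0]; positivity
  have hT1 : 1 ≤ bigT D ^ 2 := one_le_pow₀ (by rw [bigT]; exact Real.one_le_exp (by positivity))
  have hP4le : 2 * P4 D ≤ 2 * (bigP D * t0 D) := by
    rw [P4]
    have : bigP D / bigT D ^ 2 * t0 D ≤ bigP D * t0 D :=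
      mul_le_mul_of_nonneg_right (div_le_self hP0.le hT1) ht0.le
    linarith
  have hℓ9 : 1 ≤ ell D ^ 9 := one_le_pow₀ hℓ
  rcases Nat.eq_zero_or_pos ⌊2 * P4 D⌋₊ with h0 | hpos
  · rw [h0, Nat.cast_zero, Real.log_zero]; positivity
  have hKpos : (0 : ℝ) < (⌊2 * P4 D⌋₊ : ℝ) := by exact_mod_cast hpos
  have hKle : (⌊2 * P4 D⌋₊ : ℝ) ≤ 2 * (bigP D * t0 D) :=
    (Nat.floor_le (by linarith [P4_nonneg D])).trans hP4le
  have hlog2 : Real.log 2 < 1 := by linarith [Real.log_two_lt_d9]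
  have hlogt : Real.log (t0 D) ≤ 519 * ell D := by
    rw [t0, Real.log_pow]
    push_cast
    exact mul_le_mul_of_nonneg_left (Real.log_le_self hℓ0.le) (by norm_num)
  have hℓ9' : ell D ≤ ell D ^ 9 := le_self_pow₀ hℓ (by norm_num)
  calc Real.log (⌊2 * P4 D⌋₊ : ℝ) ≤ Real.log (2 * (bigP D * t0 D)) := Real.log_le_log hKpos hKle
    _ = Real.log 2 + (ell D ^ 9 + Real.log (t0 D)) := by
        rw [Real.log_mul (by norm_num) (by positivity), Real.log_mul hP0.ne' ht0.ne', bigP, Real.log_exp]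
    _ ≤ 1 + (ell D ^ 9 + 519 * ell D) := by linarith
    _ ≤ 522 * ell D ^ 9 := by nlinarith

/-- `⌊2P₄⌋ ≥ 2` for `𝓛 ≥ 2` (`P₄ = PT⁻²t₀ ≥ 1`: `𝓛⁹ ≥ 2𝓛^{1.1}`, `t₀ ≥ 1`). [cite: Zhang2022LandauSiegel, §6 p.30] -/
private theorem two_le_floor_two_P4 {D : ℕ} (hℓ : 2 ≤ ell D) : 2 ≤ ⌊2 * P4 D⌋₊ := by
  have hℓ1 : 1 ≤ ell D := by linarith
  have hℓ0 : 0 ≤ ell D := by linarith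
  -- `𝓛^{1.1} ≤ 𝓛²` and `2𝓛² ≤ 𝓛⁹`
  have ha2 : ell D ^ (1.1 : ℝ) ≤ ell D ^ 2 := by
    have h := Real.rpow_le_rpow_of_exponent_le hℓ1 (show (1.1 : ℝ) ≤ 2 by norm_num)
    rwa [Real.rpow_two] at h
  have h7 : (2 : ℝ) ≤ ell D ^ 7 := by
    calc (2 : ℝ) ≤ 2 ^ 7 := by norm_num
      _ ≤ ell D ^ 7 := by gcongr
  have h9 : 2 * ell D ^ 2 ≤ ell D ^ 9 := by
    have : ell D ^ 9 = ell D ^ 7 * ell D ^ 2 := by ring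
    rw [this]; nlinarith [pow_nonneg hℓ0 2]
  have hTP : bigT D ^ 2 ≤ bigP D := by
    rw [bigT, bigP, ← Real.exp_nat_mul, Real.exp_le_exp]
    push_cast
    linarith
  have ht1 : 1 ≤ t0 D := by rw [t0]; exact one_le_pow₀ hℓ1
  have hT0 : 0 < bigT D ^ 2 := pow_pos (Real.exp_pos _) 2
  have hP4 : 1 ≤ P4 D := by
    rw [P4]
    have h1 : 1 ≤ bigP D / bigT D ^ 2 := by rw [le_div_iff₀ hT0, one_mul]; exact hTP
    calc (1 : ℝ) = 1 * 1 := (mul_one _).symm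
      _ ≤ bigP D / bigT D ^ 2 * t0 D := mul_le_mul h1 ht1 zero_le_one (by positivity)
  have h2 : (2 : ℝ) ≤ 2 * P4 D := by linarith
  have : ((2 : ℕ) : ℝ) ≤ 2 * P4 D := by exact_mod_cast h2
  exact Nat.le_floor this

/-! ## Divisor sums: `Σ τ₂τ₅/n`, `k/φ(k) ≤ τ₂(k)`, `Σ τ₂/φ` -/

/-- **`Σ_{n≤X} τ₂(n)τ₅(n)/n ≤ M·(log X)¹⁰`** (`X ≥ 2`; `τ₂τ₅` multiplicative, `= 10` at primes, `≤ (ν+1)⁷` at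
`p^ν`; `MeanSquareMajorant.sum_div_le`). [cite: Zhang2022LandauSiegel, §16 (16.5) p.91] -/
theorem sum_tau_two_mul_tau_five_div_le {X : ℕ} (hX : 2 ≤ X) :
    ∑ n ∈ Finset.Icc 1 X, MeanSquareMajorant.tau 2 n * MeanSquareMajorant.tau 5 n / n ≤
      MeanSquareMajorant.majorantConst 10 7 * Real.log X ^ 10 := by
  have hm2 := MeanSquareMajorant.isMultiplicative_tau 2
  have hm5 := MeanSquareMajorant.isMultiplicative_tau 5
  have h := MeanSquareMajorant.sum_div_le
    (f := fun n => MeanSquareMajorant.tau 2 n * MeanSquareMajorant.tau 5 n) (a := 10) (d := 7) (K := 0)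
    (by simp [MeanSquareMajorant.tau_apply_one])
    (fun m n hmn => by
      simp only [hm2.map_mul_of_coprime hmn, hm5.map_mul_of_coprime hmn]; ring)
    (fun n => mul_nonneg (MeanSquareMajorant.tau_nonneg _ _) (MeanSquareMajorant.tau_nonneg _ _)) le_rfl
    (fun p hp => by
      rw [MeanSquareMajorant.tau_prime 2 hp, MeanSquareMajorant.tau_prime 5 hp]; norm_num)
    (fun p ν hp => by
      have h2 := MeanSquareMajorant.tau_prime_pow_le 2 hp ν
      have h5 := MeanSquareMajorant.tau_prime_pow_le 5 hp ν
      have h20 : 0 ≤ MeanSquareMajorant.tau 2 (p ^ ν) := MeanSquareMajorant.tau_nonneg _ _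
      calc MeanSquareMajorant.tau 2 (p ^ ν) * MeanSquareMajorant.tau 5 (p ^ ν)
          ≤ ((ν : ℝ) + 1) ^ 2 * ((ν : ℝ) + 1) ^ 5 := mul_le_mul h2 h5 (MeanSquareMajorant.tau_nonneg _ _)
              (by positivity)
        _ = ((ν : ℝ) + 1) ^ 7 := by ring) hX
  simpa only [zero_mul, Real.exp_zero, mul_one] using h

/-- **`k/φ(k) ≤ τ₂(k)`** for `k ≥ 1` (`k/φ(k) = ∏_{p∣k} p/(p−1) ≤ 2^{ω(k)} ≤ τ₂(k)`), the size of the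
weight `μχ(k)/(kφ(k))` of (16.3) against `1/k²`-type sums. [cite: Zhang2022LandauSiegel, §16 (16.3) p.89] -/
theorem self_div_totient_le_tau_two {k : ℕ} (hk : k ≠ 0) :
    (k : ℝ) / (Nat.totient k : ℝ) ≤ MeanSquareMajorant.tau 2 k := by
  have hφ : 0 < Nat.totient k := Nat.totient_pos.mpr (Nat.pos_of_ne_zero hk)
  have hφr : (0 : ℝ) < Nat.totient k := by exact_mod_cast hφ
  have hid := Nat.totient_mul_prod_primeFactors k
  have hprod : ∏ p ∈ k.primeFactors, (p : ℝ) ≤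
      (2 : ℝ) ^ k.primeFactors.card * ∏ p ∈ k.primeFactors, ((p - 1 : ℕ) : ℝ) := by
    rw [← Finset.prod_const, ← Finset.prod_mul_distrib]
    refine Finset.prod_le_prod (fun p _ => Nat.cast_nonneg p) fun p hp => ?_
    have h2 := (Nat.prime_of_mem_primeFactors hp).two_le
    have : ((p - 1 : ℕ) : ℝ) = (p : ℝ) - 1 := by
      rw [Nat.cast_sub (by omega)]; simp
    rw [this]
    have : (2 : ℝ) ≤ p := by exact_mod_cast h2
    linarith
  have htau : (2 : ℝ) ^ k.primeFactors.card ≤ MeanSquareMajorant.tau 2 k := by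
    rw [MeanSquareMajorant.tau_two_apply]
    have h : 2 ^ k.primeFactors.card ≤ k.divisors.card := by
      rw [Nat.card_divisors hk]
      refine Finset.pow_card_le_prod _ _ _ fun p hp => ?_
      have : 0 < k.factorization p := Nat.Prime.factorization_pos_of_dvd (Nat.prime_of_mem_primeFactors hp)
        hk (Nat.dvd_of_mem_primeFactors hp)
      omega
    exact_mod_cast h
  have hP0 : 0 < ∏ p ∈ k.primeFactors, ((p - 1 : ℕ) : ℝ) := by
    refine Finset.prod_pos fun p hp => ?_
    have h2 := (Nat.prime_of_mem_primeFactors hp).two_le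
    exact_mod_cast (show 0 < p - 1 by omega)
  have hidR : (Nat.totient k : ℝ) * ∏ p ∈ k.primeFactors, (p : ℝ) =
      (k : ℝ) * ∏ p ∈ k.primeFactors, ((p - 1 : ℕ) : ℝ) := by
    have h := congrArg (fun n : ℕ => (n : ℝ)) hid
    push_cast at h
    exact h
  rw [div_le_iff₀ hφr]
  -- `k·∏(p−1) = φ(k)∏p ≤ φ(k)·2^ω·∏(p−1)`, cancel `∏(p−1) > 0`
  have h1 : (k : ℝ) * ∏ p ∈ k.primeFactors, ((p - 1 : ℕ) : ℝ) ≤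
      (MeanSquareMajorant.tau 2 k * (Nat.totient k : ℝ)) * ∏ p ∈ k.primeFactors, ((p - 1 : ℕ) : ℝ) := by
    calc (k : ℝ) * ∏ p ∈ k.primeFactors, ((p - 1 : ℕ) : ℝ)
        = (Nat.totient k : ℝ) * ∏ p ∈ k.primeFactors, (p : ℝ) := hidR.symm
      _ ≤ (Nat.totient k : ℝ) * ((2 : ℝ) ^ k.primeFactors.card * ∏ p ∈ k.primeFactors, ((p - 1 : ℕ) : ℝ)) :=
          mul_le_mul_of_nonneg_left hprod hφr.le
      _ ≤ (Nat.totient k : ℝ) * (MeanSquareMajorant.tau 2 k * ∏ p ∈ k.primeFactors, ((p - 1 : ℕ) : ℝ)) :=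
          mul_le_mul_of_nonneg_left (mul_le_mul_of_nonneg_right htau hP0.le) hφr.le
      _ = (MeanSquareMajorant.tau 2 k * (Nat.totient k : ℝ)) * ∏ p ∈ k.primeFactors, ((p - 1 : ℕ) : ℝ) := by
          ring
  exact le_of_mul_le_mul_right h1 hP0

/-- **`Σ_{1≤k≤X} τ₂(k)/φ(k) ≤ M·(log X)⁴`** for `X ≥ 2` (`1/φ(k) ≤ τ₂(k)/k`, `Σ τ₂²/k ≤ M(log X)⁴`,
`MeanSquareMajorant.sum_tau_sq_div_le`). [cite: Zhang2022LandauSiegel, §16 (16.3) p.89] -/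
theorem sum_tau_two_div_totient_le {X : ℕ} (hX : 2 ≤ X) :
    ∑ k ∈ Finset.Icc 1 X, MeanSquareMajorant.tau 2 k / (Nat.totient k : ℝ) ≤
      MeanSquareMajorant.majorantConst (2 ^ 2) (2 * 2) * Real.log X ^ (2 ^ 2) := by
  refine le_trans (Finset.sum_le_sum fun k hk => ?_) (MeanSquareMajorant.sum_tau_sq_div_le 2 hX)
  have hk1 : 1 ≤ k := (Finset.mem_Icc.mp hk).1
  have hk0 : k ≠ 0 := by omega
  have hkR : (0 : ℝ) < k := by exact_mod_cast hk1
  have hφ : (0 : ℝ) < Nat.totient k := by exact_mod_cast Nat.totient_pos.mpr hk1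
  have h := self_div_totient_le_tau_two hk0
  have hτ0 : 0 ≤ MeanSquareMajorant.tau 2 k := MeanSquareMajorant.tau_nonneg _ _
  -- `τ₂/φ = τ₂·(k/φ)/k ≤ τ₂²/k`
  rw [div_le_div_iff₀ hφ hkR]
  calc MeanSquareMajorant.tau 2 k * (k : ℝ) = MeanSquareMajorant.tau 2 k * ((k : ℝ) / Nat.totient k) *
        (Nat.totient k : ℝ) := by field_simp
    _ ≤ MeanSquareMajorant.tau 2 k * MeanSquareMajorant.tau 2 k * (Nat.totient k : ℝ) :=
        mul_le_mul_of_nonneg_right (mul_le_mul_of_nonneg_left h hτ0) hφ.le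
    _ = MeanSquareMajorant.tau 2 k ^ 2 * (Nat.totient k : ℝ) := by ring


section Main

variable (c' : ℝ)

set_option maxHeartbeats 400000 in
/-- **u015 (weighted, polynomial rate, on the support of `b₁`) ⇒ u018 (weighted)** (§16 p. 90, tex
L4484–L4508): from the display u015 with error `C·τ₂(d₁)·∏_{q∣d₁d₂k}(1+c₀/q^{9/10})·𝓛⁻²⁰⁰·(Dpk/l₂)` for
`l₂ < 2T²P^{1/2}max(P₂,P₃)` (support of `b₁`), the display u018 with error `C′·τ₂(k)·𝓛⁻⁸⁰·Dpk` follows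
(both inline; u011 is the tree theorem `step16_u011_holds`; the weight is summed via
`prod_primeFactors_weight_le`, `τ₂(dk) ≤ τ₂(d)τ₂(k)`, `Σ_{d≤K}τ₂τ₅/d ≪ (log K)¹⁰`).
[cite: Zhang2022LandauSiegel, §16 p.90 (u015–u018)] -/
theorem step16_u018w_of_u015ww
    (h15 : ∃ c₀ C : ℝ, ForAllLarge fun D _ χ => AssumptionA D χ →
      ∀ p ∈ primeWindow D, ∀ d₁ d₂ k l₂ : ℕ, 1 ≤ d₁ → 1 ≤ d₂ → 1 ≤ k → 1 ≤ l₂ →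
        (l₂ : ℝ) < 2 * bigT D ^ 2 * (bigP D ^ (1 / 2 : ℝ) * max (Skeleton.P2 D) (P3 D)) →
        ((d₁ * d₂ * k : ℕ) : ℝ) < 2 * P4 D →
        ‖(∑' l₁ : ℕ, if Nat.Coprime l₁ (d₂ * k) then
              kappa2 c' D (d₁ * l₁) * χ (l₁ : ZMod D) *
                DeltaW D (((l₁ * l₂ : ℕ) : ℝ) / ((D : ℝ) * p * k))
            else 0) -
            calR2star c' χ * (((D : ℝ) * p * k / l₂ : ℝ) : ℂ) * kappaTilde2 c' χ d₁ (d₂ * k) 1 *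
              lam2 c' χ (d₁ * d₂ * k) 1‖ ≤
          C * (d₁.divisors.card : ℝ) * (∏ q ∈ (d₁ * d₂ * k).primeFactors, (1 + c₀ / (q : ℝ) ^ (9 / 10 : ℝ))) *
            (ell D ^ 200)⁻¹ * ((D : ℝ) * p * k / l₂)) :
    ∃ C : ℝ, ForAllLarge fun D _ χ => AssumptionA D χ →
      ∀ p ∈ primeWindow D, ∀ k : ℕ, 1 ≤ k → (k : ℝ) < 2 * P4 D →
        ‖(∑ d ∈ Finset.Icc 1 ⌊2 * P4 D⌋₊, gTilde16 c' D ((d * k : ℕ) : ℝ) / (d : ℂ) *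
              ∑' l : ℕ, if Nat.Coprime l k then
                kappa2Star c' χ (d * l) * χ (l : ZMod D) * DeltaW D ((l : ℝ) / ((D : ℝ) * p * k)) else 0) -
            calR2star c' χ * ((D : ℝ) * p * k : ℝ) *
              ∑ d₁ ∈ Finset.Icc 1 ⌊2 * P4 D⌋₊, ∑ d₂ ∈ Finset.Icc 1 ⌊2 * P4 D⌋₊,
                gTilde16 c' D ((d₁ * d₂ * k : ℕ) : ℝ) / ((d₁ : ℂ) * d₂) *
                  kappaTilde2 c' χ d₁ (d₂ * k) 1 * lam2 c' χ (d₁ * d₂ * k) 1 *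
                  ∑ l₂ ∈ (Finset.Ico 1 ⌈bigP D⌉₊).filter (fun l₂ => Nat.Coprime l₂ k),
                    b1coef c' χ (d₂ * l₂) * χ (l₂ : ZMod D) / (l₂ : ℂ)‖ ≤
          C * (k.divisors.card : ℝ) * (ell D ^ 80)⁻¹ * ((D : ℝ) * p * k) := by
  obtain ⟨c₀, C, h15'⟩ := h15
  set C' : ℝ := |C| with hC'
  have hC'0 : 0 ≤ C' := abs_nonneg _
  set c₁ : ℝ := |c₀| with hc₁
  have hc₁0 : 0 ≤ c₁ := abs_nonneg _
  set Kc : ℝ := (1 + c₁) ^ (⌈c₁⌉₊ ^ 2 + 1) with hKc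
  have hKc0 : 0 ≤ Kc := by positivity
  set Cb : ℝ := (1 + ‖iota2‖) * (‖iota3‖ + ‖iota4‖) with hCb
  have hCb0 : 0 ≤ Cb := by positivity
  set M10 : ℝ := MeanSquareMajorant.majorantConst 10 7 with hM10
  have hM100 : 0 ≤ M10 := (MeanSquareMajorant.majorantConst_pos _ _).le
  refine ⟨C' * Kc * Cb * (3 ^ 3 * 522 ^ 10) * M10, ?_⟩
  obtain ⟨D₁, h₁⟩ := h15'.and (step16_u011_holds c')
  refine ⟨max D₁ ⌈Real.exp 10⌉₊, fun D _ χ hD hq hp hA p hpW k hk1 hkP4 => ?_⟩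
  have hD₁ : D₁ ≤ D := le_trans (le_max_left _ _) hD
  have hℓ10 : 10 ≤ ell D := le_ell_of_ceil_exp_le'' (le_trans (le_max_right _ _) hD)
  have hℓ1 : 1 ≤ ell D := by linarith
  have hℓ2 : 2 ≤ ell D := by linarith
  have hℓ0 : 0 < ell D := by linarith
  obtain ⟨e15, e11⟩ := h₁ D χ hD₁ hq hp
  have h15p := e15 hA p hpW
  have h11p := e11 p hpW
  have hp0 : 0 < p := (Finset.mem_filter.mp hpW).2.pos
  have hpR : (0 : ℝ) < p := by exact_mod_cast hp0
  have hD0 : (0 : ℝ) < D := by exact_mod_cast NeZero.pos D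
  have hkR : (0 : ℝ) < k := by exact_mod_cast hk1
  have hα0 : 0 ≤ alpha D := (alpha_pos_of_ell_pos hℓ0).le
  have hα100 : 0 ≤ alpha D ^ 100 := pow_nonneg hα0 100
  set K : ℕ := ⌊2 * P4 D⌋₊ with hK
  set N : ℕ := ⌈bigP D⌉₊ with hN
  set R : ℂ := calR2star c' χ with hR
  set X : ℝ := (D : ℝ) * p * k with hX
  have hX0 : 0 < X := by positivity
  set Sb : ℝ := 2 * bigT D ^ 2 * (bigP D ^ (1 / 2 : ℝ) * max (Skeleton.P2 D) (P3 D)) with hSb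
  set Lf : Finset ℕ := (Finset.Ico 1 N).filter (fun l₂ => Nat.Coprime l₂ k) with hLf
  set r : ℝ := (ell D ^ 200)⁻¹ with hr
  have hr0 : 0 < r := by positivity
  -- the Euler-product weight (with `|c₀|`) and its comparison with `τ₂`
  set w : ℕ → ℝ := fun n => ∏ q ∈ n.primeFactors, (1 + c₁ / (q : ℝ) ^ (9 / 10 : ℝ)) with hw
  have hw0 : ∀ n, 0 ≤ w n := fun n => Finset.prod_nonneg fun q _ => by positivity
  have hwabs : ∀ n : ℕ, |∏ q ∈ n.primeFactors, (1 + c₀ / (q : ℝ) ^ (9 / 10 : ℝ))| ≤ w n := by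
    intro n
    rw [Finset.abs_prod]
    refine Finset.prod_le_prod (fun q _ => abs_nonneg _) fun q hq => ?_
    have hq9 : 0 < (q : ℝ) ^ (9 / 10 : ℝ) := by
      have : (0 : ℝ) < q := by exact_mod_cast (Nat.prime_of_mem_primeFactors hq).pos
      positivity
    calc |1 + c₀ / (q : ℝ) ^ (9 / 10 : ℝ)| ≤ |(1 : ℝ)| + |c₀ / (q : ℝ) ^ (9 / 10 : ℝ)| := abs_add_le _ _
      _ = 1 + c₁ / (q : ℝ) ^ (9 / 10 : ℝ) := by rw [abs_one, abs_div, abs_of_pos hq9]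
  have hwτ : ∀ d : ℕ, 1 ≤ d → w (d * k) ≤ Kc * (MeanSquareMajorant.tau 2 d * MeanSquareMajorant.tau 2 k) := by
    intro d hd
    have hdk0 : d * k ≠ 0 := Nat.mul_ne_zero (by omega) (by omega)
    calc w (d * k) ≤ Kc * MeanSquareMajorant.tau 2 (d * k) := prod_primeFactors_weight_le hc₁0 hdk0
      _ ≤ Kc * (MeanSquareMajorant.tau 2 d * MeanSquareMajorant.tau 2 k) :=
          mul_le_mul_of_nonneg_left (MeanSquareMajorant.tau_mul_le 2 d k) hKc0
  have hτk0 : 0 ≤ MeanSquareMajorant.tau 2 k := MeanSquareMajorant.tau_nonneg _ _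
  -- the inner series `I(e,l₂)`, its main term, the `l`-series `T(d)` and its main part `M(d)`
  set I : ℕ × ℕ → ℕ → ℂ := fun e l₂ => ∑' l₁ : ℕ, if Nat.Coprime l₁ (e.2 * k) then
      kappa2 c' D (e.1 * l₁) * χ (l₁ : ZMod D) * DeltaW D (((l₁ * l₂ : ℕ) : ℝ) / X) else 0 with hI
  set mI : ℕ × ℕ → ℕ → ℂ := fun e l₂ =>
      R * ((X / l₂ : ℝ) : ℂ) * kappaTilde2 c' χ e.1 (e.2 * k) 1 * lam2 c' χ (e.1 * e.2 * k) 1 with hmI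
  set T : ℕ → ℂ := fun d => ∑' l : ℕ, if Nat.Coprime l k then
      kappa2Star c' χ (d * l) * χ (l : ZMod D) * DeltaW D ((l : ℝ) / X) else 0 with hT
  set M : ℕ → ℂ := fun d => ∑ e ∈ d.divisorsAntidiagonal, ∑ l₂ ∈ Lf,
      b1coef c' χ (e.2 * l₂) * χ (l₂ : ZMod D) * mI e l₂ with hM
  -- the u018 main summand
  set f : ℕ × ℕ → ℂ := fun q => gTilde16 c' D ((q.1 * q.2 * k : ℕ) : ℝ) / ((q.1 : ℂ) * q.2) *
      kappaTilde2 c' χ q.1 (q.2 * k) 1 * lam2 c' χ (q.1 * q.2 * k) 1 *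
      ∑ l₂ ∈ Lf, b1coef c' χ (q.2 * l₂) * χ (l₂ : ZMod D) / (l₂ : ℂ) with hf
  -- (1) u011: `T(d) = Σ_e Σ_{l₂} b₁χ · I`
  have hTe : ∀ d : ℕ, 1 ≤ d → T d = ∑ e ∈ d.divisorsAntidiagonal, ∑ l₂ ∈ Lf,
      b1coef c' χ (e.2 * l₂) * χ (l₂ : ZMod D) * I e l₂ := fun d hd => h11p d k hd hk1
  -- (2) the insertion bound for one `d` with `dk < 2P₄`
  set u : ℝ := ell D ^ 9 with hu
  have hlogN : 1 + Real.log (N : ℝ) ≤ 3 * u := one_add_log_ceil_bigP_le' hℓ1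
  have hlogN0 : 0 ≤ 1 + Real.log (N : ℝ) := by
    have := Real.log_natCast_nonneg N; linarith
  have hTM : ∀ d ∈ Finset.Icc 1 K, ((d * k : ℕ) : ℝ) < 2 * P4 D →
      ‖T d - M d‖ ≤ C' * (Kc * (MeanSquareMajorant.tau 2 d * MeanSquareMajorant.tau 2 k)) * r * X *
        (Cb * (1 + Real.log (N : ℝ)) ^ 3) * MeanSquareMajorant.tau 5 d := by
    intro d hd hdk
    have hd1 : 1 ≤ d := (Finset.mem_Icc.mp hd).1
    rw [hTe d hd1]
    simp only [hM]
    rw [← Finset.sum_sub_distrib]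
    have hinner : ∀ e ∈ d.divisorsAntidiagonal,
        ‖(∑ l₂ ∈ Lf, b1coef c' χ (e.2 * l₂) * χ (l₂ : ZMod D) * I e l₂) -
            ∑ l₂ ∈ Lf, b1coef c' χ (e.2 * l₂) * χ (l₂ : ZMod D) * mI e l₂‖ ≤
          C' * (Kc * (MeanSquareMajorant.tau 2 d * MeanSquareMajorant.tau 2 k)) * r * X *
            (Cb * (1 + Real.log (N : ℝ)) ^ 3) *
            (MeanSquareMajorant.tau 2 e.1 * MeanSquareMajorant.tau 3 e.2) := by
      intro e he
      obtain ⟨hprod, hd0⟩ := Nat.mem_divisorsAntidiagonal.mp he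
      have he1 : 1 ≤ e.1 := Nat.one_le_iff_ne_zero.mpr fun h => hd0 (by rw [← hprod, h, zero_mul])
      have he2 : 1 ≤ e.2 := Nat.one_le_iff_ne_zero.mpr fun h => hd0 (by rw [← hprod, h, mul_zero])
      have hdk' : ((e.1 * e.2 * k : ℕ) : ℝ) < 2 * P4 D := by rw [hprod]; exact hdk
      rw [← Finset.sum_sub_distrib]
      -- termwise
      have hWd : w (e.1 * e.2 * k) ≤ Kc * (MeanSquareMajorant.tau 2 d * MeanSquareMajorant.tau 2 k) := by
        rw [hprod]; exact hwτ d hd1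
      have hterm : ∀ l₂ ∈ Lf,
          ‖b1coef c' χ (e.2 * l₂) * χ (l₂ : ZMod D) * I e l₂ -
              b1coef c' χ (e.2 * l₂) * χ (l₂ : ZMod D) * mI e l₂‖ ≤
            ‖b1coef c' χ (e.2 * l₂)‖ / (l₂ : ℝ) *
              (C' * (e.1.divisors.card : ℝ) * (Kc * (MeanSquareMajorant.tau 2 d * MeanSquareMajorant.tau 2 k)) *
                r * X) := by
        intro l₂ hl₂
        have hl₂1 : 1 ≤ l₂ := (Finset.mem_Ico.mp (Finset.mem_filter.mp hl₂).1).1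
        have hl₂R : (0 : ℝ) < l₂ := by exact_mod_cast hl₂1
        rw [← mul_sub, norm_mul, norm_mul]
        by_cases hb : b1coef c' χ (e.2 * l₂) = 0
        · rw [hb]; simp
        have hrange : (l₂ : ℝ) < Sb := by
          have h1 : ((e.2 * l₂ : ℕ) : ℝ) < Sb := by
            by_contra hge
            exact hb (b1coef_eq_zero_of_le c' χ (not_lt.mp hge))
          have h2 : (l₂ : ℝ) ≤ ((e.2 * l₂ : ℕ) : ℝ) := by exact_mod_cast Nat.le_mul_of_pos_left l₂ he2
          linarith
        have hu := h15p e.1 e.2 k l₂ he1 he2 hk1 hl₂1 hrange hdk'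
        have hχ1 : ‖χ (l₂ : ZMod D)‖ ≤ 1 := DirichletCharacter.norm_le_one χ _
        -- `C τ₂(d₁) ∏ r (X/l₂) ≤ |C| τ₂(d₁) |∏| r (X/l₂) ≤ C' τ₂(d₁) (Kc τ₂(d)τ₂(k)) r (X/l₂)`
        have hu' : ‖I e l₂ - mI e l₂‖ ≤ C' * (e.1.divisors.card : ℝ) *
            (Kc * (MeanSquareMajorant.tau 2 d * MeanSquareMajorant.tau 2 k)) * r * (X / l₂) := by
          have hu0 : ‖I e l₂ - mI e l₂‖ ≤ C * (e.1.divisors.card : ℝ) *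
              (∏ q ∈ (e.1 * e.2 * k).primeFactors, (1 + c₀ / (q : ℝ) ^ (9 / 10 : ℝ))) * r * (X / l₂) := by
            simpa only [hI, hmI, hX, hr] using hu
          refine hu0.trans ?_
          have hτ0 : 0 ≤ (e.1.divisors.card : ℝ) := Nat.cast_nonneg _
          have hXl : 0 ≤ X / l₂ := div_nonneg hX0.le hl₂R.le
          calc C * (e.1.divisors.card : ℝ) *
                (∏ q ∈ (e.1 * e.2 * k).primeFactors, (1 + c₀ / (q : ℝ) ^ (9 / 10 : ℝ))) * r * (X / l₂)
              ≤ |C * (e.1.divisors.card : ℝ) *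
                (∏ q ∈ (e.1 * e.2 * k).primeFactors, (1 + c₀ / (q : ℝ) ^ (9 / 10 : ℝ))) * r * (X / l₂)| :=
                le_abs_self _
            _ = C' * (e.1.divisors.card : ℝ) *
                |∏ q ∈ (e.1 * e.2 * k).primeFactors, (1 + c₀ / (q : ℝ) ^ (9 / 10 : ℝ))| * r * (X / l₂) := by
                rw [abs_mul, abs_mul, abs_mul, abs_mul, abs_of_nonneg hτ0, abs_of_pos hr0, abs_of_nonneg hXl]
            _ ≤ C' * (e.1.divisors.card : ℝ) * w (e.1 * e.2 * k) * r * (X / l₂) := by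
                have := hwabs (e.1 * e.2 * k)
                gcongr
            _ ≤ C' * (e.1.divisors.card : ℝ) *
                (Kc * (MeanSquareMajorant.tau 2 d * MeanSquareMajorant.tau 2 k)) * r * (X / l₂) := by
                gcongr
        calc ‖b1coef c' χ (e.2 * l₂)‖ * ‖χ (l₂ : ZMod D)‖ * ‖I e l₂ - mI e l₂‖
            ≤ ‖b1coef c' χ (e.2 * l₂)‖ * 1 * (C' * (e.1.divisors.card : ℝ) *
                (Kc * (MeanSquareMajorant.tau 2 d * MeanSquareMajorant.tau 2 k)) * r * (X / l₂)) :=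
              mul_le_mul (mul_le_mul_of_nonneg_left hχ1 (norm_nonneg _)) hu' (norm_nonneg _)
                (mul_nonneg (norm_nonneg _) zero_le_one)
          _ = ‖b1coef c' χ (e.2 * l₂)‖ / (l₂ : ℝ) *
              (C' * (e.1.divisors.card : ℝ) * (Kc * (MeanSquareMajorant.tau 2 d * MeanSquareMajorant.tau 2 k)) *
                r * X) := by
              ring
      refine (norm_sum_le _ _).trans ((Finset.sum_le_sum hterm).trans ?_)
      rw [← Finset.sum_mul]
      -- `Σ_{l₂ ∈ Lf} |b₁(e.2 l₂)|/l₂ ≤ C_b τ₃(e.2) (1 + log N)³`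
      have hbsum : ∑ l₂ ∈ Lf, ‖b1coef c' χ (e.2 * l₂)‖ / (l₂ : ℝ) ≤
          Cb * MeanSquareMajorant.tau 3 e.2 * (1 + Real.log (N : ℝ)) ^ 3 := by
        have hsub : Lf ⊆ Finset.Icc 1 N := by
          intro l hl
          have := Finset.mem_Ico.mp (Finset.mem_filter.mp hl).1
          simp only [Finset.mem_Icc]; omega
        calc ∑ l₂ ∈ Lf, ‖b1coef c' χ (e.2 * l₂)‖ / (l₂ : ℝ)
            ≤ ∑ l₂ ∈ Finset.Icc 1 N, ‖b1coef c' χ (e.2 * l₂)‖ / (l₂ : ℝ) :=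
              Finset.sum_le_sum_of_subset_of_nonneg hsub fun l _ _ => by positivity
          _ ≤ ∑ l₂ ∈ Finset.Icc 1 N, Cb * (MeanSquareMajorant.tau 3 (e.2 * l₂) / (l₂ : ℝ)) :=
              Finset.sum_le_sum fun l₂ hl₂ => by
                have hb := Skeleton.norm_b1coef_le c' χ hℓ2 (e.2 * l₂)
                rw [one_mul] at hb
                rw [← mul_div_assoc]
                exact div_le_div_of_nonneg_right hb (Nat.cast_nonneg _)
          _ = Cb * ∑ l₂ ∈ Finset.Icc 1 N, MeanSquareMajorant.tau 3 (e.2 * l₂) / (l₂ : ℝ) := by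
              rw [Finset.mul_sum]
          _ ≤ Cb * (MeanSquareMajorant.tau 3 e.2 * (1 + Real.log (N : ℝ)) ^ 3) :=
              mul_le_mul_of_nonneg_left (MeanSquareMajorant.sum_tau_mul_div_Icc_le 3 e.2 N) hCb0
          _ = _ := by ring
      have hτ2 : (e.1.divisors.card : ℝ) = MeanSquareMajorant.tau 2 e.1 :=
        (MeanSquareMajorant.tau_two_apply e.1).symm
      rw [hτ2]
      have hτ20 : 0 ≤ MeanSquareMajorant.tau 2 e.1 := MeanSquareMajorant.tau_nonneg _ _
      have hKτ0 : 0 ≤ Kc * (MeanSquareMajorant.tau 2 d * MeanSquareMajorant.tau 2 k) :=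
        mul_nonneg hKc0 (mul_nonneg (MeanSquareMajorant.tau_nonneg _ _) hτk0)
      calc (∑ l₂ ∈ Lf, ‖b1coef c' χ (e.2 * l₂)‖ / (l₂ : ℝ)) *
            (C' * MeanSquareMajorant.tau 2 e.1 * (Kc * (MeanSquareMajorant.tau 2 d * MeanSquareMajorant.tau 2 k)) *
              r * X)
          ≤ (Cb * MeanSquareMajorant.tau 3 e.2 * (1 + Real.log (N : ℝ)) ^ 3) *
            (C' * MeanSquareMajorant.tau 2 e.1 * (Kc * (MeanSquareMajorant.tau 2 d * MeanSquareMajorant.tau 2 k)) *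
              r * X) :=
            mul_le_mul_of_nonneg_right hbsum
              (mul_nonneg (mul_nonneg (mul_nonneg (mul_nonneg hC'0 hτ20) hKτ0) hr0.le) hX0.le)
        _ = _ := by ring
    refine (norm_sum_le _ _).trans ((Finset.sum_le_sum hinner).trans ?_)
    rw [← Finset.mul_sum, show (5 : ℕ) = 2 + 3 from rfl, MeanSquareMajorant.tau_add_apply]
  -- (3) the exact regrouping of the main terms
  have hMf : ∀ d ∈ Finset.Icc 1 K,
      gTilde16 c' D ((d * k : ℕ) : ℝ) / (d : ℂ) * M d =
        R * (X : ℂ) * ∑ e ∈ d.divisorsAntidiagonal, f e := by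
    intro d hd
    simp only [hM, hf]
    rw [Finset.mul_sum, Finset.mul_sum]
    refine Finset.sum_congr rfl fun e he => ?_
    obtain ⟨hprod, _⟩ := Nat.mem_divisorsAntidiagonal.mp he
    rw [Finset.mul_sum, Finset.mul_sum, Finset.mul_sum]
    refine Finset.sum_congr rfl fun l₂ _ => ?_
    simp only [hmI]
    rw [← hprod]
    push_cast
    ring
  have hregroup : ∑ d ∈ Finset.Icc 1 K, gTilde16 c' D ((d * k : ℕ) : ℝ) / (d : ℂ) * M d =
      R * (X : ℂ) * ∑ d₁ ∈ Finset.Icc 1 K, ∑ d₂ ∈ Finset.Icc 1 K, f (d₁, d₂) := by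
    rw [Finset.sum_congr rfl hMf, ← Finset.mul_sum, ← Finset.Ico_add_one_right_eq_Icc,
      sum_Ico_Ico_eq_sum_divisorsAntidiagonal (K + 1) f]
    intro q hq1 hq2 hq
    -- `q.1 q.2 ≥ K + 1 > 2P₄` ⇒ `g̃₂(q.1 q.2 k) = 0`
    have hgt : 2 * P4 D < ((q.1 * q.2 : ℕ) : ℝ) := by
      have h1 : 2 * P4 D < (K : ℝ) + 1 := Nat.lt_floor_add_one _
      have h2 : (K : ℝ) + 1 ≤ ((q.1 * q.2 : ℕ) : ℝ) := by exact_mod_cast hq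
      linarith
    have hle : ((q.1 * q.2 : ℕ) : ℝ) ≤ ((q.1 * q.2 * k : ℕ) : ℝ) := by
      exact_mod_cast Nat.le_mul_of_pos_right _ hk1
    have hpos : (0 : ℝ) < ((q.1 * q.2 * k : ℕ) : ℝ) := by
      have : 0 ≤ 2 * P4 D := by have := P4_nonneg D; positivity
      linarith
    simp only [hf]
    rw [gTilde16_eq_zero_of_le c' hpos (by linarith), zero_div, zero_mul, zero_mul, zero_mul]
  -- (4) the difference as `Σ_d g̃₂(dk)/d (T d − M d)`
  have hdiff : (∑ d ∈ Finset.Icc 1 K, gTilde16 c' D ((d * k : ℕ) : ℝ) / (d : ℂ) * T d) -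
      R * (X : ℂ) * ∑ d₁ ∈ Finset.Icc 1 K, ∑ d₂ ∈ Finset.Icc 1 K, f (d₁, d₂) =
      ∑ d ∈ Finset.Icc 1 K, gTilde16 c' D ((d * k : ℕ) : ℝ) / (d : ℂ) * (T d - M d) := by
    rw [← hregroup, ← Finset.sum_sub_distrib]
    refine Finset.sum_congr rfl fun d _ => ?_
    ring
  -- (5) per-`d` bound of the weighted difference, including `dk ≥ 2P₄` (then `g̃₂(dk) = 0`)
  set Wc : ℝ := C' * (Kc * MeanSquareMajorant.tau 2 k) * r * X * (Cb * (1 + Real.log (N : ℝ)) ^ 3) with hWc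
  have hWc0 : 0 ≤ Wc :=
    mul_nonneg (mul_nonneg (mul_nonneg (mul_nonneg hC'0 (mul_nonneg hKc0 hτk0)) hr0.le) hX0.le)
      (mul_nonneg hCb0 (pow_nonneg hlogN0 3))
  have hper : ∀ d ∈ Finset.Icc 1 K,
      ‖gTilde16 c' D ((d * k : ℕ) : ℝ) / (d : ℂ) * (T d - M d)‖ ≤
        Wc * (MeanSquareMajorant.tau 2 d * MeanSquareMajorant.tau 5 d / d) := by
    intro d hd
    have hd1 : 1 ≤ d := (Finset.mem_Icc.mp hd).1
    have hdR : (0 : ℝ) < d := by exact_mod_cast hd1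
    by_cases hdk : ((d * k : ℕ) : ℝ) < 2 * P4 D
    · rw [norm_mul, norm_div, Complex.norm_natCast]
      have hg : ‖gTilde16 c' D ((d * k : ℕ) : ℝ)‖ ≤ 1 := Skeleton.norm_gTilde16_le c' hℓ0 (d * k)
      have hTM' : ‖T d - M d‖ ≤ Wc * (MeanSquareMajorant.tau 2 d * MeanSquareMajorant.tau 5 d) := by
        refine (hTM d hd hdk).trans (le_of_eq ?_)
        simp only [hWc]; ring
      calc ‖gTilde16 c' D ((d * k : ℕ) : ℝ)‖ / d * ‖T d - M d‖
          ≤ 1 / d * (Wc * (MeanSquareMajorant.tau 2 d * MeanSquareMajorant.tau 5 d)) :=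
            mul_le_mul (div_le_div_of_nonneg_right hg hdR.le) hTM' (norm_nonneg _)
              (div_nonneg zero_le_one hdR.le)
        _ = Wc * (MeanSquareMajorant.tau 2 d * MeanSquareMajorant.tau 5 d / d) := by ring
    · have hpos : (0 : ℝ) < ((d * k : ℕ) : ℝ) := by positivity
      rw [gTilde16_eq_zero_of_le c' hpos (not_lt.mp hdk), zero_div, zero_mul, norm_zero]
      exact mul_nonneg hWc0 (div_nonneg (mul_nonneg (MeanSquareMajorant.tau_nonneg _ _)
        (MeanSquareMajorant.tau_nonneg _ _)) hdR.le)
  -- (6) assemble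
  have hK2 : 2 ≤ K := two_le_floor_two_P4 hℓ2
  have hlogK' : Real.log (K : ℝ) ≤ 522 * u := log_floor_two_P4_le' hℓ1
  have hlogK0' : 0 ≤ Real.log (K : ℝ) := Real.log_natCast_nonneg K
  have hsum10 : ∑ d ∈ Finset.Icc 1 K, MeanSquareMajorant.tau 2 d * MeanSquareMajorant.tau 5 d / (d : ℝ) ≤
      M10 * Real.log (K : ℝ) ^ 10 := sum_tau_two_mul_tau_five_div_le hK2
  -- `r · u^{13} = 𝓛^{117}/𝓛^{200} ≤ 𝓛⁻⁸⁰`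
  have hrate : r * (u ^ 3 * u ^ 10) ≤ (ell D ^ 80)⁻¹ := by
    simp only [hr, hu]
    rw [← pow_mul, ← pow_mul, ← pow_add, inv_mul_le_iff₀ (pow_pos hℓ0 200), ← div_eq_mul_inv,
      le_div_iff₀ (pow_pos hℓ0 80), ← pow_add]
    exact pow_le_pow_right₀ hℓ1 (by norm_num)
  have hmain : ‖(∑ d ∈ Finset.Icc 1 K, gTilde16 c' D ((d * k : ℕ) : ℝ) / (d : ℂ) * T d) -
      R * (X : ℂ) * ∑ d₁ ∈ Finset.Icc 1 K, ∑ d₂ ∈ Finset.Icc 1 K, f (d₁, d₂)‖ ≤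
      C' * Kc * Cb * (3 ^ 3 * 522 ^ 10) * M10 * (k.divisors.card : ℝ) * (ell D ^ 80)⁻¹ * X := by
    rw [hdiff]
    have hτk : (k.divisors.card : ℝ) = MeanSquareMajorant.tau 2 k := (MeanSquareMajorant.tau_two_apply k).symm
    calc ‖∑ d ∈ Finset.Icc 1 K, gTilde16 c' D ((d * k : ℕ) : ℝ) / (d : ℂ) * (T d - M d)‖
        ≤ ∑ d ∈ Finset.Icc 1 K, Wc * (MeanSquareMajorant.tau 2 d * MeanSquareMajorant.tau 5 d / d) :=
          (norm_sum_le _ _).trans (Finset.sum_le_sum hper)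
      _ = Wc * ∑ d ∈ Finset.Icc 1 K, MeanSquareMajorant.tau 2 d * MeanSquareMajorant.tau 5 d / (d : ℝ) := by
          rw [Finset.mul_sum]
      _ ≤ Wc * (M10 * Real.log (K : ℝ) ^ 10) := mul_le_mul_of_nonneg_left hsum10 hWc0
      _ ≤ Wc * (M10 * (522 * u) ^ 10) := by
          refine mul_le_mul_of_nonneg_left (mul_le_mul_of_nonneg_left ?_ hM100) hWc0
          exact pow_le_pow_left₀ hlogK0' hlogK' 10
      _ ≤ (C' * (Kc * MeanSquareMajorant.tau 2 k) * r * X * (Cb * (3 * u) ^ 3)) * (M10 * (522 * u) ^ 10) := by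
          refine mul_le_mul_of_nonneg_right ?_ (by positivity)
          simp only [hWc]
          exact mul_le_mul_of_nonneg_left
            (mul_le_mul_of_nonneg_left (pow_le_pow_left₀ hlogN0 hlogN 3) hCb0)
            (mul_nonneg (mul_nonneg (mul_nonneg hC'0 (mul_nonneg hKc0 hτk0)) hr0.le) hX0.le)
      _ = C' * Kc * Cb * (3 ^ 3 * 522 ^ 10) * M10 * MeanSquareMajorant.tau 2 k * (r * (u ^ 3 * u ^ 10)) * X := by
          ring
      _ ≤ C' * Kc * Cb * (3 ^ 3 * 522 ^ 10) * M10 * MeanSquareMajorant.tau 2 k * (ell D ^ 80)⁻¹ * X := by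
          have h0 : 0 ≤ C' * Kc * Cb * (3 ^ 3 * 522 ^ 10) * M10 * MeanSquareMajorant.tau 2 k := by
            positivity
          exact mul_le_mul_of_nonneg_right (mul_le_mul_of_nonneg_left hrate h0) hX0.le
      _ = _ := by rw [hτk]
  -- match the statement of u018
  have hLHS : (∑ d ∈ Finset.Icc 1 K, gTilde16 c' D ((d * k : ℕ) : ℝ) / (d : ℂ) *
        ∑' l : ℕ, if Nat.Coprime l k then
          kappa2Star c' χ (d * l) * χ (l : ZMod D) * DeltaW D ((l : ℝ) / ((D : ℝ) * p * k)) else 0) =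
      ∑ d ∈ Finset.Icc 1 K, gTilde16 c' D ((d * k : ℕ) : ℝ) / (d : ℂ) * T d := by
    simp only [hT, hX]
  have hRHS : calR2star c' χ * ((D : ℝ) * p * k : ℝ) *
        ∑ d₁ ∈ Finset.Icc 1 K, ∑ d₂ ∈ Finset.Icc 1 K,
          gTilde16 c' D ((d₁ * d₂ * k : ℕ) : ℝ) / ((d₁ : ℂ) * d₂) *
            kappaTilde2 c' χ d₁ (d₂ * k) 1 * lam2 c' χ (d₁ * d₂ * k) 1 *
            ∑ l₂ ∈ (Finset.Ico 1 N).filter (fun l₂ => Nat.Coprime l₂ k),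
              b1coef c' χ (d₂ * l₂) * χ (l₂ : ZMod D) / (l₂ : ℂ) =
      R * (X : ℂ) * ∑ d₁ ∈ Finset.Icc 1 K, ∑ d₂ ∈ Finset.Icc 1 K, f (d₁, d₂) := by
    simp only [hR, hX, hf, hLf]
  rw [hLHS, hRHS]
  simpa only [hX] using hmain

end Main

end Literature.NumberTheory.LFunctions.Zhang2022.Typed.Section16A
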